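import Mathlib

/-!
# Layer-chain Liouville with WINDOWS and INFINITE-RANGE outer couplings — the abstract kernel of PS «ProfileSlaving»
(decomp-a2c lens-3 g22; critic rows 396 (3)(ii), 407 (5)(ii); extends the tree module `…Theorems.ChartedPlanarOrderLayerChainLiouville`)

The tree kernel `layerChain_stability` / `layerChain_unique` takes a THREE-argument balance map `Φ m a b c` (couplings up to second
layers), GLOBAL strong monotonicity in the middle argument and a GLOBAL Lipschitz constant in the outer ones.  The LJ instantiation that
PS needs differs in exactly two typed respects, supplied here:
* INFINITE RANGE — the stress transmitted across gap `m` depends on EVERY increment: `Φ m : (ℤ → E) → E`; the outer couplings are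
  measured by ONE sup-norm Lipschitz constant `K` («changing the increments off `m` by at most `t` each, inside the windows, moves
  `Φ m` by at most `K·t`»; for LJ `K = 2κ₁ + 2Σ_{d≥2} κ_d`, a convergent tail), condition `K < λ`;
* WINDOWS — monotonicity and Lipschitz bounds are required only for increment profiles inside prescribed windows `W m ⊆ E` (the clean
  increments with the letter of gap `m`; TAG 138′ supplies `λ`, `K` THERE and nowhere else), and both compared profiles live in the windows.
PROVED: `layerChainTail_stability` (discrete maximum principle: residuals `ρ`-close ⇒ profiles `ρ/(λ−K)`-close), `layerChainTail_unique`,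
`translation_of_increments_eq` (equal increments ⇒ the offset profiles differ by a translation = PS's conclusion shape), and
(consistency with the tree's three-argument kernel `layerChain_stability` = the special case `K = 2κ`, `W = univ`; that restatement is omitted at landing, `dedup.landed`).
AND THE «SAME σ» STEP (finite coupling range `R` in ℓ¹ form `‖Φ m h − Φ m h'‖ ≤ Σ_{|j|≤R} κ j ‖h(m+j) − h'(m+j)‖`, `Σ_{j≠0} κ j < λ`):
`slaving_pointwise`, `slaving_block` (block-summed monotonicity: `(λ−K) Σ_{[a,b]} ‖d‖² ≤ ‖σ−σ'‖·D₂ + K R D₂²` uniformly, the stress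
term telescoping against the bounded block sums `‖Σ_{[a,b]} d‖ ≤ D₂`), `eventually_small_of_block_bound`, `slaving_stress_eq` (bounded
relative offsets ⇒ σ = σ'), and ★ `slaving_translation` — the full ABSTRACT PS: two balanced increment profiles in the windows whose offset
profiles stay at bounded distance differ by a translation.
AND THE ℓ¹ KERNEL (v3, section `SlavingL1`): the same four steps with INFINITE coupling range — `‖Φ m h − Φ m h'‖ ≤ Σ'_j κ j ‖h(m+j) − h'(m+j)‖`
with `Summable κ`, `Summable (|j|·κ j)` (first moment) and `Σ' κ − κ 0 < λ`: `slavingL1_pointwise`, `slavingL1_block`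
(`(λ−K) Σ_{[a,b]} ‖d‖² ≤ ‖σ−σ'‖·D₂ + K₁ D₂²`, `K₁ = Σ' |j| κ j` replacing `K R`), `slavingL1_stress_eq` (finite part eventually small + small
tail of the convergent series), ★ `slavingL1_translation` — binder-for-binder the hypothesis list of E1 `SlavingKernelL1` of
`…Theorems.ChartedPlanarOrderProfileSlavingLJ` (lens-3 g22), which it therefore proves outright once both modules are in the tree.
What remains for PS proper is the LJ DICTIONARY (Nash layered state ⇒ balanced chain = D1 `NashBalance`; TAG 138′ ⇒ λ, κ on the clean tube =
W `TubeMonotone`) — `…ProfileSlavingLJ` / MEMO-g22-PS.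
Pure Mathlib; def-free; sorry-free.
-/

noncomputable section

open scoped RealInnerProductSpace

namespace Summit.AtomisticToContinuum.Crystallization.Theorems.ChartedPlanarOrderLayerChainLiouvilleTail

variable {E : Type*} [NormedAddCommGroup E] [InnerProductSpace ℝ E]

/-- **Stability with windows and infinite-range outer couplings (discrete maximum principle).** -/
theorem layerChainTail_stability (Φ : ℤ → (ℤ → E) → E) (W : ℤ → Set E) {lam K : ℝ} (hK : 0 ≤ K) (hdom : K < lam)
    (hmono : ∀ m : ℤ, ∀ h : ℤ → E, (∀ k, h k ∈ W k) → ∀ b' ∈ W m,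
      lam * ‖h m - b'‖ ^ 2 ≤ ⟪Φ m h - Φ m (Function.update h m b'), h m - b'⟫)
    (hlip : ∀ m : ℤ, ∀ h h' : ℤ → E, (∀ k, h k ∈ W k) → (∀ k, h' k ∈ W k) → h m = h' m →
      ∀ t : ℝ, (∀ k, ‖h k - h' k‖ ≤ t) → ‖Φ m h - Φ m h'‖ ≤ K * t)
    (g g' : ℤ → E) (hg : ∀ k, g k ∈ W k) (hg' : ∀ k, g' k ∈ W k) {D : ℝ} (hD : ∀ m, ‖g m - g' m‖ ≤ D)
    {ρ : ℝ} (hρ : 0 ≤ ρ) (hres : ∀ m, ‖Φ m g - Φ m g'‖ ≤ ρ) :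
    ∀ m, ‖g m - g' m‖ ≤ ρ / (lam - K) := by
  have hlam : 0 < lam := by linarith
  have hgap : 0 < lam - K := by linarith
  set S : Set ℝ := Set.range fun m : ℤ => ‖g m - g' m‖ with hS
  have hSne : S.Nonempty := ⟨‖g 0 - g' 0‖, ⟨0, rfl⟩⟩
  have hSbdd : BddAbove S := ⟨D, by rintro _ ⟨m, rfl⟩; exact hD m⟩
  set Dst : ℝ := sSup S with hDst
  have hle : ∀ m, ‖g m - g' m‖ ≤ Dst := fun m => le_csSup hSbdd ⟨m, rfl⟩
  have hDst0 : 0 ≤ Dst := le_trans (norm_nonneg _) (hle 0)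
  -- pointwise bootstrap: λ‖d m‖ ≤ ρ + K·Dst
  have key : ∀ m, lam * ‖g m - g' m‖ ≤ ρ + K * Dst := by
    intro m
    -- the mixed profile: `g` off `m`, `g' m` at `m`
    obtain ⟨h', hh'⟩ : ∃ h' : ℤ → E, h' = Function.update g m (g' m) := ⟨_, rfl⟩
    have hh'm : h' m = g' m := by rw [hh', Function.update_self]
    have hh'k : ∀ k, k ≠ m → h' k = g k := fun k hk => by rw [hh', Function.update_of_ne hk]
    have hh'W : ∀ k, h' k ∈ W k := fun k => by
      by_cases hk : k = m
      · rw [hk, hh'm]; exact hg' m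
      · rw [hh'k k hk]; exact hg k
    by_cases hd0 : g m - g' m = 0
    · rw [hd0, norm_zero, mul_zero]; nlinarith [mul_nonneg hK hDst0]
    have hdpos : 0 < ‖g m - g' m‖ := norm_pos_iff.mpr hd0
    have h1 : lam * ‖g m - g' m‖ ^ 2 ≤ ⟪Φ m g - Φ m h', g m - g' m⟫ := by
      rw [hh']; exact hmono m g hg (g' m) (hg' m)
    have hsplit : Φ m g - Φ m h' = (Φ m g - Φ m g') + (Φ m g' - Φ m h') := by abel
    have hb' : ‖Φ m g' - Φ m h'‖ ≤ K * Dst := by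
      refine hlip m g' h' hg' hh'W hh'm.symm Dst (fun k => ?_)
      by_cases hk : k = m
      · rw [hk, hh'm, sub_self, norm_zero]; exact hDst0
      · rw [hh'k k hk, norm_sub_rev]; exact hle k
    have h2 : ⟪Φ m g - Φ m h', g m - g' m⟫ ≤ (ρ + K * Dst) * ‖g m - g' m‖ := by
      rw [hsplit, inner_add_left]
      have ha := real_inner_le_norm (Φ m g - Φ m g') (g m - g' m)
      have hb := real_inner_le_norm (Φ m g' - Φ m h') (g m - g' m)
      have hres' := hres m
      nlinarith [norm_nonneg (g m - g' m), norm_nonneg (Φ m g - Φ m g'), norm_nonneg (Φ m g' - Φ m h')]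
    have h4 : lam * ‖g m - g' m‖ * ‖g m - g' m‖ ≤ (ρ + K * Dst) * ‖g m - g' m‖ := by
      rw [mul_assoc, ← sq]; exact h1.trans h2
    exact le_of_mul_le_mul_right h4 hdpos
  -- take the supremum: λ·Dst ≤ ρ + K·Dst
  have hsup : lam * Dst ≤ ρ + K * Dst := by
    have h1 : Dst ≤ (ρ + K * Dst) / lam := by
      refine csSup_le hSne ?_
      rintro _ ⟨m, rfl⟩
      rw [le_div_iff₀ hlam, mul_comm]
      exact key m
    have := (le_div_iff₀ hlam).1 h1
    linarith
  have hDst_le : Dst ≤ ρ / (lam - K) := by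
    rw [le_div_iff₀ hgap]; nlinarith
  exact fun m => (hle m).trans hDst_le

/-- **Uniqueness = profile slaving (windows, infinite range).** Same transmitted stress at every gap ⇒ the two window-valued profiles
at bounded distance coincide. -/
theorem layerChainTail_unique (Φ : ℤ → (ℤ → E) → E) (W : ℤ → Set E) {lam K : ℝ} (hK : 0 ≤ K) (hdom : K < lam)
    (hmono : ∀ m : ℤ, ∀ h : ℤ → E, (∀ k, h k ∈ W k) → ∀ b' ∈ W m,
      lam * ‖h m - b'‖ ^ 2 ≤ ⟪Φ m h - Φ m (Function.update h m b'), h m - b'⟫)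
    (hlip : ∀ m : ℤ, ∀ h h' : ℤ → E, (∀ k, h k ∈ W k) → (∀ k, h' k ∈ W k) → h m = h' m →
      ∀ t : ℝ, (∀ k, ‖h k - h' k‖ ≤ t) → ‖Φ m h - Φ m h'‖ ≤ K * t)
    (g g' : ℤ → E) (hg : ∀ k, g k ∈ W k) (hg' : ∀ k, g' k ∈ W k) {D : ℝ} (hD : ∀ m, ‖g m - g' m‖ ≤ D)
    (heq : ∀ m, Φ m g = Φ m g') : g = g' := by
  funext m
  have h := layerChainTail_stability Φ W hK hdom hmono hlip g g' hg hg' hD le_rfl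
    (fun m => by rw [heq m, sub_self, norm_zero]) m
  rw [zero_div] at h
  exact sub_eq_zero.1 (norm_le_zero_iff.1 h)

omit [InnerProductSpace ℝ E] in
/-- **equal increments ⇒ translation** (PS's conclusion shape): if two offset profiles have the same increments, they differ by a
constant. -/
theorem translation_of_increments_eq {w w' : ℤ → E} (h : ∀ m : ℤ, w' m - w' (m - 1) = w m - w (m - 1)) :
    ∀ m : ℤ, w' m - w m = w' 0 - w 0 := by
  have step : ∀ m : ℤ, w' m - w m = w' (m - 1) - w (m - 1) := fun m => by
    have := h m
    -- w' m - w' (m-1) = w m - w (m-1)  ⇒  w' m - w m = w' (m-1) - w (m-1)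
    rw [sub_eq_sub_iff_add_eq_add] at this ⊢
    rw [add_comm (w' (m - 1)), ← this, add_comm]
  intro m
  induction m using Int.induction_on with
  | zero => rfl
  | succ n ih =>
    have := step ((n : ℤ) + 1)
    rw [add_sub_cancel_right] at this
    rw [this, ih]
  | pred n ih =>
    have := step (-(n : ℤ))
    rw [← ih, this]

omit [InnerProductSpace ℝ E] in
/-- the offsets themselves: equal increment profiles ⇒ `w' = w + c`. -/
theorem exists_translation_of_increments_eq {w w' : ℤ → E} (h : ∀ m : ℤ, w' m - w' (m - 1) = w m - w (m - 1)) :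
    ∃ c : E, ∀ m, w' m = w m + c :=
  ⟨w' 0 - w 0, fun m => by rw [← translation_of_increments_eq h m]; abel⟩

/-! (Consistency section `layerChain_stability_of_tail` — the tree's three-argument kernel as the special case `K = 2κ`, `W = univ` —
omitted at landing: the gate's `dedup.landed` identifies it with `…ChartedPlanarOrderLayerChainLiouville.layerChain_stability`.) -/

end Summit.AtomisticToContinuum.Crystallization.Theorems.ChartedPlanarOrderLayerChainLiouvilleTail

end
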